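import Mathlib
import Summits.Ventures.PercRepro2.LocRows
import Summits.Ventures.PercRepro2.SwRow
import Summits.Ventures.PercRepro2.SwOut
import Summits.Ventures.PercRepro2.SwAllRow
import Summits.Ventures.PercRepro2.SwOutAll
import Summits.Ventures.PercRepro2.SwOutArmFlip
import Summits.Ventures.PercRepro2.SwOutArmThm
import Summits.Ventures.PercRepro2.SwOutJunction
import Summits.Ventures.PercRepro2.SwOutJunctionRegion
import Summits.Ventures.PercRepro2.SwOutCoreDefs
import Summits.Ventures.PercRepro2.SwOutCoreKey
import Summits.Ventures.PercRepro2.SwOutJunctionH1Defs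

/-!
# The (H1) single junction: the arms of the extended hull (blind cell PercRepro2, night-4 g13,
2026-08-26; proofs/NIGHT4-G13.md §4 (C1))

The arms of a configuration are the components of `G[H⁺ ∖ {h, u}]` (`armC`), `H⁺` the extended
hull.  This file: an arm lies in `H⁺ ∖ {h, u}` (`armC_subset`), is closed under adjacency inside
`H⁺ ∖ {h, u}` (`mem_armC_of_edge`), two arms coincide or are disjoint (`armC_eq_of_mem`); the
finite set `armsC` of arms reached by an edge from `h` or `u` (`armC_mem_armsC`,
`exists_of_mem_armsC`), its members being pairwise disjoint, nonempty, without edges between two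
of them — the combinatorial fields of a `CoreBase`.  The arms depend on the configuration only
through its extended hull (`armC_eq_of_extHull_eq`, `armsC_eq_of_extHull_eq`).
-/

namespace Summit.Ventures.PercRepro2

namespace LocRows

open Hull

variable {V : Type*} {E : Type*} [Fintype E] [DecidableEq E]

open scoped Classical

variable {ends : E → Sym2 V} {h u : V} {ζ : Config E}

omit [Fintype E] [DecidableEq E] in
/-- The arm colouring is open exactly on the edges inside `H⁺ ∖ {h, u}`. -/
lemma armConfigC_eq_true_iff {e : E} :
    armConfigC ends h u ζ e = true ↔ e ∈ within ends (extHull ends ζ h u \ {h, u}) := by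
  simp [armConfigC]

omit [Fintype E] [DecidableEq E] in
/-- The arm of a vertex of `H⁺ ∖ {h, u}` lies in `H⁺ ∖ {h, u}`. -/
lemma armC_subset {x : V} (hx : x ∈ extHull ends ζ h u) (hxh : x ≠ h) (hxu : x ≠ u) :
    armC ends h u ζ x ⊆ extHull ends ζ h u \ {h, u} := by
  intro v hv
  refine mem_of_conn_of_closed (ends := ends) (ω := armConfigC ends h u ζ) ?_
    ⟨hx, by simp [hxh, hxu]⟩ hv
  intro a _ b hab
  obtain ⟨_, e, he, hends⟩ := openGraph_adj.1 hab
  obtain ⟨x', hx', y', hy', h'⟩ := armConfigC_eq_true_iff.1 he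
  rw [hends, Sym2.eq_iff] at h'
  rcases h' with ⟨_, rfl⟩ | ⟨_, rfl⟩
  · exact hy'
  · exact hx'

omit [Fintype E] [DecidableEq E] in
/-- Arms are closed under adjacency inside `H⁺ ∖ {h, u}`. -/
lemma mem_armC_of_edge {x a b : V} {e : E} (ha : a ∈ armC ends h u ζ x)
    (haH : a ∈ extHull ends ζ h u) (hah : a ≠ h) (hau : a ≠ u) (hbH : b ∈ extHull ends ζ h u)
    (hbh : b ≠ h) (hbu : b ≠ u) (hends : ends e = s(a, b)) : b ∈ armC ends h u ζ x := by
  have he : armConfigC ends h u ζ e = true :=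
    armConfigC_eq_true_iff.2 ⟨a, ⟨haH, by simp [hah, hau]⟩, b, ⟨hbH, by simp [hbh, hbu]⟩, hends⟩
  exact mem_cluster_of_edge ha he hends

omit [Fintype E] [DecidableEq E] in
/-- `x` lies in its arm. -/
lemma mem_armC_self (x : V) : x ∈ armC ends h u ζ x := mem_cluster_self _ _ _

omit [Fintype E] [DecidableEq E] in
/-- The arm of a vertex of the arm of `x` is the arm of `x`. -/
lemma armC_eq_of_mem {x y : V} (hy : y ∈ armC ends h u ζ x) :
    armC ends h u ζ y = armC ends h u ζ x := by
  ext v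
  constructor
  · exact fun hv => conn_trans hy hv
  · exact fun hv => conn_trans (conn_symm hy) hv

omit [Fintype E] [DecidableEq E] in
/-- The arms depend only on the extended hull. -/
lemma armC_eq_of_extHull_eq {ζ' : Config E} (hH : extHull ends ζ' h u = extHull ends ζ h u)
    (x : V) : armC ends h u ζ' x = armC ends h u ζ x := by
  unfold armC armConfigC
  rw [hH]

omit [DecidableEq E] in
/-- A junction edge and its arm. -/
lemma exists_of_mem_junctionEdges {e : E} (he : e ∈ junctionEdges ends h u ζ) :
    ∃ y, (ends e = s(h, y) ∨ ends e = s(u, y)) ∧ y ≠ h ∧ y ≠ u ∧ y ∈ extHull ends ζ h u ∧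
      armOfEdgeC ends h u ζ e = armC ends h u ζ y := by
  simp only [junctionEdges, Finset.mem_filter, Finset.mem_univ, true_and] at he
  obtain ⟨y, hy, hyh, hyu, hyH⟩ := he
  refine ⟨y, hy, hyh, hyu, hyH, ?_⟩
  ext x
  simp only [armOfEdgeC, Set.mem_setOf_eq]
  constructor
  · rintro ⟨y', hy', hy'h, hy'u, hx⟩
    rcases hy with hy | hy <;> rw [hy, Sym2.mem_iff] at hy' <;> rcases hy' with rfl | rfl
    · exact absurd rfl hy'h
    · exact hx
    · exact absurd rfl hy'u
    · exact hx
  · intro hx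
    refine ⟨y, ?_, hyh, hyu, hx⟩
    rcases hy with hy | hy <;> rw [hy] <;> exact Sym2.mem_mk_right _ _

omit [DecidableEq E] in
/-- The arm of a vertex of `H⁺ ∖ {h, u}` reached by an edge from `h` or from `u` is an arm. -/
lemma armC_mem_armsC (hhu : h ≠ u) {y : V} (hyH : y ∈ extHull ends ζ h u) (hyh : y ≠ h)
    (hyu : y ≠ u) {e : E} (he : ends e = s(h, y) ∨ ends e = s(u, y)) :
    armC ends h u ζ y ∈ armsC ends h u ζ := by
  have hej : e ∈ junctionEdges ends h u ζ := by
    simp only [junctionEdges, Finset.mem_filter, Finset.mem_univ, true_and]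
    exact ⟨y, he, hyh, hyu, hyH⟩
  obtain ⟨y', hy', _, _, _, hP⟩ := exists_of_mem_junctionEdges hej
  have hyy' : y' = y := by
    rcases he with he | he <;> rcases hy' with hy' | hy' <;> rw [he, Sym2.eq_iff] at hy'
    · rcases hy' with ⟨_, h2⟩ | ⟨_, h2⟩
      · exact h2.symm
      · exact absurd h2 hyh
    · rcases hy' with ⟨h1, _⟩ | ⟨_, h2⟩
      · exact absurd h1 hhu
      · exact absurd h2 hyu
    · rcases hy' with ⟨h1, _⟩ | ⟨_, h2⟩
      · exact absurd h1.symm hhu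
      · exact absurd h2 hyh
    · rcases hy' with ⟨_, h2⟩ | ⟨_, h2⟩
      · exact h2.symm
      · exact absurd h2 hyu
  subst hyy'
  rw [← hP]
  exact Finset.mem_image_of_mem _ hej

omit [DecidableEq E] in
/-- Every arm is the arm of a vertex of `H⁺ ∖ {h, u}`. -/
lemma exists_of_mem_armsC {P : Set V} (hP : P ∈ armsC ends h u ζ) :
    ∃ y, y ∈ extHull ends ζ h u ∧ y ≠ h ∧ y ≠ u ∧ P = armC ends h u ζ y := by
  obtain ⟨e, he, rfl⟩ := Finset.mem_image.1 hP
  obtain ⟨y, _, hyh, hyu, hyH, hP⟩ := exists_of_mem_junctionEdges he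
  exact ⟨y, hyH, hyh, hyu, hP⟩

omit [DecidableEq E] in
/-- An arm lies in `H⁺ ∖ {h, u}`. -/
lemma armsC_subset {P : Set V} (hP : P ∈ armsC ends h u ζ) :
    ∀ x ∈ P, x ∈ extHull ends ζ h u ∧ x ≠ h ∧ x ≠ u := by
  obtain ⟨y, hyH, hyh, hyu, rfl⟩ := exists_of_mem_armsC hP
  intro x hx
  have := armC_subset hyH hyh hyu hx
  simp only [Set.mem_sdiff, Set.mem_insert_iff, Set.mem_singleton_iff, not_or] at this
  exact ⟨this.1, this.2.1, this.2.2⟩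

omit [DecidableEq E] in
/-- An arm is nonempty. -/
lemma armsC_nonempty {P : Set V} (hP : P ∈ armsC ends h u ζ) : P.Nonempty := by
  obtain ⟨y, _, _, _, rfl⟩ := exists_of_mem_armsC hP
  exact ⟨y, mem_armC_self y⟩

omit [DecidableEq E] in
/-- Two different arms are disjoint. -/
lemma armsC_disjoint {P P' : Set V} (hP : P ∈ armsC ends h u ζ) (hP' : P' ∈ armsC ends h u ζ)
    (hne : P ≠ P') (x : V) (hx : x ∈ P) : x ∉ P' := by
  obtain ⟨y, _, _, _, rfl⟩ := exists_of_mem_armsC hP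
  obtain ⟨y', _, _, _, rfl⟩ := exists_of_mem_armsC hP'
  intro hx'
  exact hne (by rw [← armC_eq_of_mem hx, ← armC_eq_of_mem hx'])

omit [DecidableEq E] in
/-- No edge joins two different arms. -/
lemma armsC_no_cross {P P' : Set V} (hP : P ∈ armsC ends h u ζ) (hP' : P' ∈ armsC ends h u ζ)
    (hne : P ≠ P') {e : E} {x y : V} (hxy : ends e = s(x, y)) (hx : x ∈ P) (hy : y ∈ P') :
    False := by
  obtain ⟨hxH, hxh, hxu⟩ := armsC_subset hP x hx
  obtain ⟨hyH, hyh, hyu⟩ := armsC_subset hP' y hy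
  obtain ⟨z, _, _, _, rfl⟩ := exists_of_mem_armsC hP
  exact armsC_disjoint hP hP' hne y (mem_armC_of_edge hx hxH hxh hxu hyH hyh hyu hxy) hy

omit [DecidableEq E] in
/-- The arms of two configurations with the same extended hull coincide. -/
lemma armsC_eq_of_extHull_eq {ζ' : Config E} (hH : extHull ends ζ' h u = extHull ends ζ h u) :
    armsC ends h u ζ' = armsC ends h u ζ := by
  have h1 : junctionEdges ends h u ζ' = junctionEdges ends h u ζ := by
    simp only [junctionEdges, hH]
  have h2 : armOfEdgeC ends h u ζ' = armOfEdgeC ends h u ζ := by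
    funext e
    simp only [armOfEdgeC, armC_eq_of_extHull_eq hH]
  simp only [armsC, h1, h2]

end LocRows

end Summit.Ventures.PercRepro2
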